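import Summits.Langlands.Langlands.Statement
import Summits.Langlands.Langlands.Theorems.IrreducibilityBySelfDualityIrreducibleGL3CMContinuousSemisimplification
import Summits.Langlands.Langlands.Theorems.IrreducibilityBySelfDualityIrreducibleGL3CMReducibleCompanion
import Literature.NumberTheory.GaloisRepresentations.LAdicRepFrobenius
import Literature.NumberTheory.GaloisRepresentations.FramedRepEquivConj
import Literature.NumberTheory.Automorphic.ChebotarevArtinRepHolds
import Literature.NumberTheory.Automorphic.AutomorphicRepsGLSatakeFlathProofs
import HarnessLib

/-!
# `ParityBlindBianchi.EvenArtinJunction` (item stmt-Langlands-2908) from four leaves — STRUCTURAL glue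
(crux-strategist planner-cstrat-stmt-Langlands-2908-r1-0, 2026-08-17, EXEMPT-46 re-exam / BC2 REDIRECT;
`--supports stmt-Langlands-2908`; imports `Summits.Langlands.Langlands.Statement` + Statement-free landed
modules + Literature only — NO `Theses` module and NO module of the `IrreducibleOffSector` transfer tower
(whose sources open the pre-D-0032 `∃ 𝓡` summit and are in drift since the re-type of 2026-08-17 04:35Z) —
so that `route edit --split EvenArtinJunction … --glue-by` can link it without an import cycle.)

The deciding crux `EvenArtinJunction := ⟨text of EvenIcosahedralStrongArtin⟩ → Langlands` of route
`ParityBlindBianchi` (shared with EvenArtinGL4Door, EvenIcosahedralCMCorner, SexticResolventInduction,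
MonomialConverse) is the summit modulo the route target (landed `parityBlindBianchi_evenArtinJunction_iff_of_target`,
re-audit bin RESTATED).  BC2 REDIRECT: this file proves, sorry-free, the typed decomposition

  `N → W_irr → B_w → C∀ → EvenArtinJunction`                      (`evenArtinJunction_of_leaves`)

against the RE-TYPED summit `Langlands = ∀ F, Nonempty (ReciprocityData F) ∧ ∀ 𝓡 n, 0 < n → ∀ hcpt, (A) ∧ (B)`
(D-0032 §4c, p141787), with the four leaves stated VERBATIM as the texts of the route's new children:

* N `ReciprocityDataNonempty` — reciprocity data exist over every number field: a local Langlands datum at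
  every completion, normalised against THE canonical local Artin map together with its `ε`-system
  (Harris–Taylor 2001 Thm. A / Henniart 2000 + local class field theory; the summit's own non-vacuity conjunct);
* W_irr `WeakExistenceIrreducible` — Buzzard–Gee Conj. 3.2.2 / Taylor 2004 Conj. (A), weak form WITH
  irreducibility: every L-algebraic cuspidal `π` of `GL_n(𝔸_K)` has, for all `ℓ`, `ι`, an IRREDUCIBLE
  `ρ : Γ_K → GL_n(ℚ̄_ℓ)`, unramified a.e., de Rham above `ℓ` for Fontaine's PINNED datum, Satake–Frobenius
  compatible with `π` at almost all places (`𝓡`-free);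
* B_w `WeakAutomorphy` — Fontaine–Mazur–Langlands, a.e. form: every irreducible pinned-geometric `ρ` is
  Satake–Frobenius compatible a.e. with some L-algebraic cuspidal `π` (`𝓡`-free; verbatim the text filed for
  `CapacityClassicality.SectorToLanglands`, stmt-Langlands-10368);
* C∀ `PairCompatibilityAll` — Taylor 2004 Conj. 7 for pairs, for ALL reciprocity data: if `π` is L-algebraic
  cuspidal, `ρ` irreducible pinned-geometric and the two are Satake–Frobenius compatible a.e., then they are
  locally–globally compatible at EVERY finite place with respect to every `𝓡 : ReciprocityData K` (the `∀ 𝓡`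
  form is forced by the re-type: an `∃ Rec`-shaped compatibility leaf no longer assembles to the summit, Q-L2).

MATHEMATICAL CONTENT OF THE SEAM.  (i) Direction (A) at `𝓡`: W_irr gives the irreducible avatar `ρ`,
C∀ its local–global compatibility at every place; UNIQUENESS up to conjugacy among all corresponding `ρ'`
is proved here: `ρ'` shares the Frobenius polynomials of `ρ` a.e. (uniqueness of Satake parameters, Flath),
hence is irreducible (Chebotarev–Brauer–Nesbitt transfer through a continuous semisimplification,
Deligne–Serre 1974 Lemme 3.2 — inlined from the drifting `IrreducibleOffSector` transfer module), hence
equivalent and conjugate to `ρ`.  (ii) Direction (B) at `𝓡`: B_w then C∀.  (iii) `Nonempty (ReciprocityData F)`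
is N.  (iv) The antecedent X (even icosahedral strong Artin, a.e.) of `EvenArtinJunction` is bound and NOT
used: no typed assembly toward `Langlands` can consume a measure-zero `GL₂/ℚ` Artin sector (census
STRATEGY-CENSUS.md on the item, §0) — the decomposition is one of `Langlands` itself, by four strictly
weaker leaves, followed by weakening.  This is (to this seat's knowledge) the first kernel-checked
factorisation of the RE-TYPED summit.

No definitions; axioms `propext`, `Classical.choice`, `Quot.sound`.

References: K. Buzzard, T. Gee, LMS LNS 414 (2014), Conj. 3.2.1–3.2.2 [BuzzardGeeLMS2014]; R. Taylor, Ann.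
Fac. Sci. Toulouse 13 (2004) 73–119, Conj. 7–8 (arXiv:math/0212403) [TaylorGaloisRepresentations2004];
J.-M. Fontaine, B. Mazur (1995), Conj. 1 [FontaineMazurGeometric1995]; M. Harris, R. Taylor, Ann. Math. Stud.
151 (2001), Thm. A [HarrisTaylorAMS2001]; G. Henniart, Invent. Math. 139 (2000), Thm. 1.2
[HenniartInventiones2000]; P. Deligne, J.-P. Serre, ASENS 7 (1974), Lemme 3.2 [DeligneSerreASENS1974];
D. Flath, Corvallis (1979), Thm. 3.
-/

noncomputable section

set_option linter.dupNamespace false -- project-wide option; `Summit.Langlands.Langlands` is the mandated namespace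

open scoped NumberField Classical
open Filter IsDedekindDomain
open Literature.NumberTheory.Automorphic Literature.NumberTheory.GaloisRepresentations
open Summit.Langlands

namespace Summit.Langlands.Langlands.Theorems.ParityBlindBianchiEvenArtinJunctionSplit

variable {n : ℕ} {K : Type} [Field K] [NumberField K] {hcpt : isCompact_glFiniteIntegralLevel n K}
  {ℓ : ℕ} [Fact ℓ.Prime]

omit [NumberField K] in
/-- An irreducible continuous Galois representation on `ℚ̄_ℓⁿ` is semisimple (a simple lattice of
subrepresentations is complemented). [folklore] -/
theorem isSemisimple_of_isIrreducible (ρ : FramedGaloisRep K (PadicAlgCl ℓ) n)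
    (h : ρ.toGaloisRep.IsIrreducible) : ρ.toGaloisRep.IsSemisimple := by
  haveI := h
  change ComplementedLattice _
  infer_instance

omit [NumberField K] in
/-- Conjugate framed representations have the same characteristic polynomials
(Mathlib `Matrix.charpoly_units_conj`). [folklore] -/
theorem charpoly_conj (P : GL (Fin n) (PadicAlgCl ℓ)) (ρ : FramedGaloisRep K (PadicAlgCl ℓ) n)
    (g : Field.absoluteGaloisGroup K) :
    FramedRep.charpoly (ρ.conj P) g = FramedRep.charpoly ρ g := by
  simp only [FramedRep.charpoly, FramedRep.conj_apply, Units.val_mul, Matrix.coe_units_inv]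
  exact Matrix.charpoly_units_conj P _

/-- **Two avatars of one `π` have equal Frobenius characteristic polynomials almost everywhere**
(uniqueness of Satake parameters, Flath 1979 Thm. 3: `hasSatakeParamAt_unique_holds`). [folklore] -/
theorem eventually_hasFrobCharpolyAt_common
    (π : AutomorphicRepData (AutomorphyDatum.gl n K hcpt)) (ι : PadicAlgCl ℓ ≃+* ℂ)
    {ρ₀ r : FramedGaloisRep K (PadicAlgCl ℓ) n}
    (h₀ : ∀ᶠ v : HeightOneSpectrum (𝓞 K) in cofinite, SatakeFrobCompatibleAt ι π ρ₀ v)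
    (hr : ∀ᶠ v : HeightOneSpectrum (𝓞 K) in cofinite, SatakeFrobCompatibleAt ι π r v) :
    ∀ᶠ v : HeightOneSpectrum (𝓞 K) in cofinite,
      ρ₀.IsUnramifiedAt v ∧ r.IsUnramifiedAt v ∧
        ∃ P : Polynomial (PadicAlgCl ℓ), ρ₀.HasFrobCharpolyAt v P ∧ r.HasFrobCharpolyAt v P := by
  filter_upwards [h₀, hr] with v hv hv'
  obtain ⟨α, hα, hur, hcp⟩ := hv
  obtain ⟨α', hα', hur', hcp'⟩ := hv'
  obtain rfl : α = α' := AutomorphicRepData.hasSatakeParamAt_unique_holds π hα hα'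
  exact ⟨hur, hur', _, hcp, hcp'⟩

/-- **Chebotarev–Brauer–Nesbitt transfer of irreducibility** (every rank, every number field): if
`ρ₀, ρ : Γ_K →ₜ* GL_n(ℚ̄_ℓ)` are unramified with a COMMON Frobenius characteristic polynomial at all but
finitely many places and `ρ₀` is irreducible, then `ρ` is irreducible — a continuous semisimplification
`r` of `ρ` is equivalent to `ρ₀` (Deligne–Serre 1974, Lemme 3.2), hence conjugate to it, so `ρ` and `ρ₀`
have the same characteristic polynomials everywhere, and Brauer–Nesbitt. (Inlined from the
`IrreducibleOffSector` transfer module, which is in drift after D-0032 §4c.)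
[cite: DeligneSerreASENS1974, Lemme 3.2] -/
theorem isIrreducible_of_eventually_hasFrobCharpolyAt_common
    {ρ₀ ρ : FramedGaloisRep K (PadicAlgCl ℓ) n} (hirr₀ : ρ₀.toGaloisRep.IsIrreducible)
    (h : ∀ᶠ v : HeightOneSpectrum (𝓞 K) in cofinite,
      ρ₀.IsUnramifiedAt v ∧ ρ.IsUnramifiedAt v ∧
        ∃ P : Polynomial (PadicAlgCl ℓ), ρ₀.HasFrobCharpolyAt v P ∧ ρ.HasFrobCharpolyAt v P) :
    ρ.toGaloisRep.IsIrreducible := by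
  obtain ⟨r, hrss, hrcp, hrker⟩ := IrreducibleGL3CM.stub_continuousSemisimplification K ℓ n ρ
  have hr : ∀ᶠ v : HeightOneSpectrum (𝓞 K) in cofinite,
      ρ₀.IsUnramifiedAt v ∧ r.IsUnramifiedAt v ∧
        ∃ P : Polynomial (PadicAlgCl ℓ), ρ₀.HasFrobCharpolyAt v P ∧ r.HasFrobCharpolyAt v P := by
    filter_upwards [h] with v hv
    obtain ⟨hur₀, hur, P, hcp₀, hcp⟩ := hv
    exact ⟨hur₀, fun 𝔓 h𝔓 σ hσ => hrker σ (hur 𝔓 h𝔓 σ hσ), P, hcp₀,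
      fun 𝔓 h𝔓 σ hσ => (hrcp σ).trans (hcp 𝔓 h𝔓 σ hσ)⟩
  obtain ⟨e⟩ := FramedGaloisRep.nonempty_equiv_of_hasFrobCharpolyAt_eventually
    chebotarev_artinRep_holds ρ₀ r (isSemisimple_of_isIrreducible ρ₀ hirr₀) hrss hr
  obtain ⟨P, hP⟩ := FramedRep.exists_eq_conj_of_equiv ρ₀ r e
  have hcp : ∀ g, FramedRep.charpoly ρ₀ g = FramedRep.charpoly ρ g := fun g => by
    rw [← hrcp g, hP, charpoly_conj]
  by_contra hirr
  exact IrreducibleGL3CM.stub_not_isIrreducible_of_charpoly_eq K ℓ n ρ ρ₀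
    (isSemisimple_of_isIrreducible ρ₀ hirr₀) hcp hirr hirr₀

/-- **Uniqueness up to conjugacy of the avatar** (the last clause of (A)): if `ρ` is irreducible and
`ρ, ρ'` are both Satake–Frobenius compatible with `(π, ι)` at almost all places, then `ρ'` is a
`GL_n(ℚ̄_ℓ)`-conjugate of `ρ` — `ρ'` is irreducible by the transfer above, both are semisimple with equal
Frobenius polynomials a.e., hence equivalent (Chebotarev + Brauer–Nesbitt) and conjugate.
[cite: DeligneSerreASENS1974, Lemme 3.2] -/
theorem isConjugate_of_satakeFrobCompatible
    (π : AutomorphicRepData (AutomorphyDatum.gl n K hcpt)) (ι : PadicAlgCl ℓ ≃+* ℂ)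
    {ρ ρ' : FramedGaloisRep K (PadicAlgCl ℓ) n} (hirr : ρ.toGaloisRep.IsIrreducible)
    (hρ : ∀ᶠ v : HeightOneSpectrum (𝓞 K) in cofinite, SatakeFrobCompatibleAt ι π ρ v)
    (hρ' : ∀ᶠ v : HeightOneSpectrum (𝓞 K) in cofinite, SatakeFrobCompatibleAt ι π ρ' v) :
    IsConjugate ρ ρ' := by
  have hev := eventually_hasFrobCharpolyAt_common π ι hρ hρ'
  have hirr' : ρ'.toGaloisRep.IsIrreducible :=
    isIrreducible_of_eventually_hasFrobCharpolyAt_common hirr hev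
  obtain ⟨e⟩ := FramedGaloisRep.nonempty_equiv_of_hasFrobCharpolyAt_eventually
    chebotarev_artinRep_holds ρ ρ' (isSemisimple_of_isIrreducible ρ hirr)
    (isSemisimple_of_isIrreducible ρ' hirr') hev
  obtain ⟨P, hP⟩ := FramedRep.exists_eq_conj_of_equiv ρ ρ' e
  exact ⟨P, hP.symm⟩

/-- **`EvenArtinJunction` from its four leaves N, W_irr, B_w, C∀** (texts verbatim; the antecedent X of
the conclusion is discarded — module docstring (iv)).  Proof: at every number field `F`, N gives the
non-vacuity conjunct; for every reciprocity datum `𝓡`, direction (A) is W_irr + C∀ with uniqueness up to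
conjugacy by `isConjugate_of_satakeFrobCompatible`, and direction (B) is B_w + C∀ (the pinned Fontaine
datum makes `IsGeometricFramed 𝓡 ρ` definitionally the `𝓡`-free geometric clause of the leaves).
[cite: BuzzardGeeLMS2014, Conj. 3.2.1 and Conj. 3.2.2] [cite: FontaineMazurGeometric1995, Conj. 1]
[cite: HarrisTaylorAMS2001, Thm. A] [cite: DeligneSerreASENS1974, Lemme 3.2] -/
theorem evenArtinJunction_of_leaves :
    (∀ (K : Type) [Field K] [NumberField K], Nonempty (ReciprocityData K)) →
    (∀ (K : Type) [Field K] [NumberField K] (n : ℕ) (hcpt : Literature.NumberTheory.Automorphic.isCompact_glFiniteIntegralLevel n K), 0 < n → ∀ π : Literature.NumberTheory.Automorphic.CuspidalAutomorphicRepData n K hcpt, π.1.IsLAlgebraic → ∀ (ℓ : ℕ) [Fact ℓ.Prime] (ι : PadicAlgCl ℓ ≃+* ℂ), ∃ ρ : Literature.NumberTheory.GaloisRepresentations.FramedGaloisRep K (PadicAlgCl ℓ) n, ρ.toGaloisRep.IsIrreducible ∧ ((∀ᶠ v : IsDedekindDomain.HeightOneSpectrum (NumberField.RingOfIntegers K)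 in cofinite, ρ.IsUnramifiedAt v) ∧ ∀ (v : IsDedekindDomain.HeightOneSpectrum (NumberField.RingOfIntegers K)) (hv : ((ℓ : ℕ) : NumberField.RingOfIntegers K) ∈ v.asIdeal), (Literature.NumberTheory.PAdicHodge.fontainePstAdicCompletion v ℓ hv).IsDeRhamFramed (ρ.toLocal v)) ∧ ∀ᶠ v : IsDedekindDomain.HeightOneSpectrum (NumberField.RingOfIntegers K) in cofinite, SatakeFrobCompatibleAt ι π.1 ρ v) →
    (∀ (K : Type) [Field K] [NumberField K] (n : ℕ) (hcpt : Literature.NumberTheory.Automorphic.isCompact_glFiniteIntegralLevel n K), 0 < n → ∀ (ℓ : ℕ) [Fact ℓ.Prime] (ι : PadicAlgCl ℓ ≃+* ℂ) (ρ : Literature.NumberTheory.GaloisRepresentations.FramedGaloisRep K (PadicAlgCl ℓ) n), ρ.toGaloisRep.IsIrreducible → ((∀ᶠ v : IsDedekindDomain.HeightOneSpectrum (NumberField.RingOfIntegers K) in cofinite, ρ.IsUnramifiedAt v) ∧ ∀ (v : IsDedekindDomain.HeightOneSpectrum (NumberField.RingOfIntegers K)) (hv : ((ℓ : ℕ) :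 NumberField.RingOfIntegers K) ∈ v.asIdeal), (Literature.NumberTheory.PAdicHodge.fontainePstAdicCompletion v ℓ hv).IsDeRhamFramed (ρ.toLocal v)) → ∃ π : Literature.NumberTheory.Automorphic.CuspidalAutomorphicRepData n K hcpt, π.1.IsLAlgebraic ∧ ∀ᶠ v : IsDedekindDomain.HeightOneSpectrum (NumberField.RingOfIntegers K) in cofinite, SatakeFrobCompatibleAt ι π.1 ρ v) →
    (∀ (K : Type) [Field K] [NumberField K] (Rec : ReciprocityData K) (n : ℕ) (hcpt : Literature.NumberTheory.Automorphic.isCompact_glFiniteIntegralLevel n K), 0 < n → ∀ (π : Literature.NumberTheory.Automorphic.CuspidalAutomorphicRepData n K hcpt), π.1.IsLAlgebraic → ∀ (ℓ : ℕ) [Fact ℓ.Prime] (ι : PadicAlgCl ℓ ≃+* ℂ) (ρ : Literature.NumberTheory.GaloisRepresentations.FramedGaloisRep K (PadicAlgCl ℓ) n), ρ.toGaloisRep.IsIrreducible → ((∀ᶠ v : IsDedekindDomain.HeightOneSpectrum (NumberField.RingOfIntegers K) in cofinite, ρ.IsUnramifiedAt v) ∧ ∀ (v : IsDedekindDomain.HeightOneSpectrum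 (NumberField.RingOfIntegers K)) (hv : ((ℓ : ℕ) : NumberField.RingOfIntegers K) ∈ v.asIdeal), (Literature.NumberTheory.PAdicHodge.fontainePstAdicCompletion v ℓ hv).IsDeRhamFramed (ρ.toLocal v)) → (∀ᶠ v : IsDedekindDomain.HeightOneSpectrum (NumberField.RingOfIntegers K) in cofinite, SatakeFrobCompatibleAt ι π.1 ρ v) → ∀ v : IsDedekindDomain.HeightOneSpectrum (NumberField.RingOfIntegers K), LocalGlobalCompatibleAt Rec ι π.1 ρ v) →
    ((∀ ρ : Literature.NumberTheory.GaloisRepresentations.FramedGaloisRep ℚ ℂ 2, ρ.toGaloisRep.IsIrreducible → Nonempty ((Matrix.ProjGenLinGroup.mk.comp ρ.toMonoidHom).range ≃* alternatingGroup (Fin 5)) → (∀ (φ : ℚ →+* ℝ) (c : Field.absoluteGaloisGroup ℚ), Literature.NumberTheory.GaloisRepresentations.IsComplexConjugation φ c → Matrix.GeneralLinearGroup.det (ρ c) = 1) → ∃ (hcpt : Literature.NumberTheory.Automorphic.isCompact_glFiniteIntegralLevel 2 ℚ) (π : Literature.NumberTheory.Automorphic.CuspidalAutomorphicRepData 2 ℚ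 hcpt), (∀ᶠ v : IsDedekindDomain.HeightOneSpectrum (NumberField.RingOfIntegers ℚ) in Filter.cofinite, ∃ α : Multiset ℂ, π.1.HasSatakeParamAt v α ∧ ρ.IsUnramifiedAt v ∧ ρ.HasFrobCharpolyAt v (Literature.NumberTheory.Automorphic.satakePolynomial α))) →
      _root_.Langlands) := by
  intro hN hW hB hC _hX F _ _
  refine ⟨hN F, fun 𝓡 n hn hcpt => ⟨?_, ?_⟩⟩
  · -- direction (A) at `𝓡`: the irreducible avatar of W_irr, its compatibility by C∀, uniqueness
    intro π hL ℓ _ ι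
    obtain ⟨ρ, hirr, hgeo, hρ⟩ := hW F n hcpt hn π hL ℓ ι
    have hcorr : Corresponds 𝓡 ι π.1 ρ := ⟨hρ, hC F 𝓡 n hcpt hn π hL ℓ ι ρ hirr hgeo hρ⟩
    exact ⟨ρ, hirr, hgeo, hcorr,
      fun ρ' hcorr' => isConjugate_of_satakeFrobCompatible π.1 ι hirr hρ hcorr'.1⟩
  · -- direction (B) at `𝓡`: B_w then C∀
    intro ℓ _ ι ρ hirr hgeo
    obtain ⟨π, hL, hρ⟩ := hB F n hcpt hn ℓ ι ρ hirr hgeo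
    exact ⟨π, hL, hρ, hC F 𝓡 n hcpt hn π hL ℓ ι ρ hirr hgeo hρ⟩

end Summit.Langlands.Langlands.Theorems.ParityBlindBianchiEvenArtinJunctionSplit

end
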